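import Mathlib
import HarnessLib
import Summits.Ventures.LatticeQCDFlow.Exactness.SphereLatticeHMCExact
import Summits.Ventures.LatticeQCDFlow.Exactness.CPNSymanzikLeapfrogHMCErgodic
import Summits.Ventures.LatticeQCDFlow.Exactness.SphereFamilyLeapfrogFTHMCErgodic

/-!
# Row 7's Engel–Schaefer lattice HMC (a lattice of site spheres, sitewise geodesic drift) IS the family kernel at constant dimension: at `nstep = 1` it is uniformly ergodic, and so is its THMC

HONEST FRAMING: exact (Metropolis-corrected) sampling algorithms for lattice gauge theory;
figures of merit are autocorrelation/cost numbers at stated couplings and volumes; no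
continuum-physics claim.

Venture `LatticeQCDFlow` (cell pub-lqcd), topic `Exactness`, FANOUT row 9 (eng-latcore) for row 7
(`s0-cpn-null`: the S0-D1 rung — 2D CP(N−1) HMC vs THMC with the molecular dynamics of
Engel–Schaefer §2.2, typed by row 7 as `SphereLatticeHMCExact.lean`: phase space
`(Λ → S^{d−1}) × (Λ → ℝ^d)`, `latticeLeapfrogPerm F δ`, `lattice_sphere_hmc_gaussian_exact`,
`lattice_sphere_thmc_config_exact`; its NOT-CLAIMED line: "ergodicity").  NEW WORK of the cell over
the gen-16 chain (`SphereFamilyLeapfrog*.lean`, `CPNSymanzikLeapfrogHMCErgodic.lean`: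
`famLeapfrogHMC_uniformlyErgodic_of_continuous`; `SphereFamilyLeapfrogFTHMCErgodic.lean`:
`famLeapfrogFTHMC_uniformlyErgodic`).  Nothing is cited as a fact.  Printed counterpart, NAMED
ONLY: Engel–Schaefer, Comput. Phys. Commun. 182 (2011) 2107, §2.2.

THE DICTIONARY IS DEFINITIONAL: for the ambient dimension `d = n + 2` (site sphere `S^{n+1}`; CP(N−1):
`n = 2N − 2`) row 7's lattice phase space, leapfrog proposal and Gaussian-momentum configuration
kernel ARE, by `rfl`, the family objects of parts 1a/1b at the constant dimension family
`fun _ : Λ => n` (`latticeProposal_eq_famProposal`, `lattice_sphere_hmc_eq_famLeapfrogHMC`).  Hence: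

* **`lattice_sphere_hmc_uniformlyErgodic`** — for every continuous action `S`, continuous
  site-coupling force field `F` and step `δ > 0`, row 7's `nstep = 1` kernel converges to
  `piGibbsLaw (⊗ uniformSphere) e^{−S}` geometrically in total variation from EVERY initial law;
  **`lattice_sphere_hmc_invariant_unique`** — that law is its unique invariant probability law.
* **`lattice_sphere_thmc_uniformlyErgodic`**, **`lattice_sphere_thmc_invariant_unique`** — the same
  for row 7's THMC kernel (modified action `S∘Φ − log J`, reported through `Φ`) for every measurable
  equivalence `Φ` with `HasJacobian (⊗ uniformSphere) Φ J`, `J` measurable and pinched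
  `0 < j₁ ≤ J ≤ j₂`, bounded measurable `S` and `F`.

NOT CLAIMED: ambient index types other than `Fin (n + 2)` (row 7 allows any finite `m` with
`card m ≥ 2`; one reindexing `m ≃ Fin (card m)` away, not written); `nstep ≥ 2`; rates; floating
point; which `Φ` the code certifies (`SphereKickSweep.lean`).
-/

noncomputable section

namespace Summit.Ventures.LatticeQCDFlow.Exactness

open MeasureTheory Measure Metric Set Real ProbabilityTheory
open scoped ENNReal InnerProductSpace

section Lattice

variable (n : ℕ) {Λ : Type*} [Fintype Λ]

omit [Fintype Λ] in
/-- **Row 7's lattice proposal IS the family proposal at constant dimension** (definitionally). -/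
theorem latticeProposal_eq_famProposal
    (F : (Λ → sphere (0 : EuclideanSpace ℝ (Fin (n + 2))) 1) → (Λ → EuclideanSpace ℝ (Fin (n + 2))))
    (δ : ℝ) (k : ℕ) :
    ⇑((latticeFlipPerm : Equiv.Perm ((Λ → sphere (0 : EuclideanSpace ℝ (Fin (n + 2))) 1) ×
        (Λ → EuclideanSpace ℝ (Fin (n + 2))))) * latticeLeapfrogPerm F δ ^ k) =
      ⇑(famProposal (k := fun _ : Λ => n) F δ k) := rfl

/-- **Row 7's Gaussian-momentum lattice HMC kernel IS `famLeapfrogHMC` at constant dimension**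
(definitionally; any trajectory length `k`). -/
theorem lattice_sphere_hmc_eq_famLeapfrogHMC
    {F : (Λ → sphere (0 : EuclideanSpace ℝ (Fin (n + 2))) 1) → (Λ → EuclideanSpace ℝ (Fin (n + 2)))}
    (hF : Measurable F) (δ : ℝ) (k : ℕ) (S : (Λ → sphere (0 : EuclideanSpace ℝ (Fin (n + 2))) 1) → ℝ) :
    refreshUpdate
        (involMH ⇑((latticeFlipPerm : Equiv.Perm ((Λ → sphere (0 : EuclideanSpace ℝ (Fin (n + 2))) 1) ×
            (Λ → EuclideanSpace ℝ (Fin (n + 2))))) * latticeLeapfrogPerm F δ ^ k)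
          (measurePreserving_latticeProposal (by rw [Fintype.card_fin]; omega) hF δ k).measurable
          fun z : (Λ → sphere (0 : EuclideanSpace ℝ (Fin (n + 2))) 1) × (Λ → EuclideanSpace ℝ (Fin (n + 2))) =>
            S z.1 + ∑ s, ‖z.2 s‖ ^ 2 / 2)
        (((Measure.pi fun _ : Λ => (volume : Measure (EuclideanSpace ℝ (Fin (n + 2))))).withDensity
            (fun p => ENNReal.ofReal (Real.exp (-(∑ s, ‖p s‖ ^ 2 / 2)))) Set.univ)⁻¹ •
          (Measure.pi fun _ : Λ => (volume : Measure (EuclideanSpace ℝ (Fin (n + 2))))).withDensity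
            fun p => ENNReal.ofReal (Real.exp (-(∑ s, ‖p s‖ ^ 2 / 2)))) =
      famLeapfrogHMC (k := fun _ : Λ => n) F δ k hF S := rfl

/-- **ROW 7's ENGEL–SCHAEFER LATTICE HMC AT `nstep = 1` IS UNIFORMLY ERGODIC**: for every continuous
action `S`, continuous site-coupling force field `F` and step `δ > 0` there is `η ∈ (0, 1]` with
`|μ₀Kᵗ(A) − π_S(A)| ≤ (1 − η)ᵗ` for every initial law `μ₀`, every `t`, every set `A`,
`π_S = piGibbsLaw (⊗ uniformSphere) e^{−S}`. -/
theorem lattice_sphere_hmc_uniformlyErgodic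
    {F : (Λ → sphere (0 : EuclideanSpace ℝ (Fin (n + 2))) 1) → (Λ → EuclideanSpace ℝ (Fin (n + 2)))}
    (hF : Continuous F) {δ : ℝ} (hδ : 0 < δ)
    {S : (Λ → sphere (0 : EuclideanSpace ℝ (Fin (n + 2))) 1) → ℝ} (hS : Continuous S) :
    ∃ η : ℝ, 0 < η ∧ η ≤ 1 ∧
      ∀ (μ₀ : Measure (Λ → sphere (0 : EuclideanSpace ℝ (Fin (n + 2))) 1)) [IsProbabilityMeasure μ₀] (t : ℕ)
        (A : Set (Λ → sphere (0 : EuclideanSpace ℝ (Fin (n + 2))) 1)),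
      |((fun m : Measure (Λ → sphere (0 : EuclideanSpace ℝ (Fin (n + 2))) 1) => m.bind
          (refreshUpdate
            (involMH ⇑((latticeFlipPerm : Equiv.Perm ((Λ → sphere (0 : EuclideanSpace ℝ (Fin (n + 2))) 1) ×
                (Λ → EuclideanSpace ℝ (Fin (n + 2))))) * latticeLeapfrogPerm F δ ^ 1)
              (measurePreserving_latticeProposal (by rw [Fintype.card_fin]; omega) hF.measurable δ 1).measurable
              fun z : (Λ → sphere (0 : EuclideanSpace ℝ (Fin (n + 2))) 1) × (Λ → EuclideanSpace ℝ (Fin (n + 2))) =>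
                S z.1 + ∑ s, ‖z.2 s‖ ^ 2 / 2)
            (((Measure.pi fun _ : Λ => (volume : Measure (EuclideanSpace ℝ (Fin (n + 2))))).withDensity
                (fun p => ENNReal.ofReal (Real.exp (-(∑ s, ‖p s‖ ^ 2 / 2)))) Set.univ)⁻¹ •
              (Measure.pi fun _ : Λ => (volume : Measure (EuclideanSpace ℝ (Fin (n + 2))))).withDensity
                fun p => ENNReal.ofReal (Real.exp (-(∑ s, ‖p s‖ ^ 2 / 2))))))^[t] μ₀).real A
        - (piGibbsLaw (fun _ : Λ => uniformSphere (volume : Measure (EuclideanSpace ℝ (Fin (n + 2)))))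
            (gibbsDensity S)).real A| ≤ (1 - η) ^ t := by
  rw [lattice_sphere_hmc_eq_famLeapfrogHMC n hF.measurable δ 1 S]
  exact famLeapfrogHMC_uniformlyErgodic_of_continuous hF hδ hS

/-- **… and `piGibbsLaw (⊗ uniformSphere) e^{−S}` is its unique invariant probability law.** -/
theorem lattice_sphere_hmc_invariant_unique
    {F : (Λ → sphere (0 : EuclideanSpace ℝ (Fin (n + 2))) 1) → (Λ → EuclideanSpace ℝ (Fin (n + 2)))}
    (hF : Continuous F) {δ : ℝ} (hδ : 0 < δ)
    {S : (Λ → sphere (0 : EuclideanSpace ℝ (Fin (n + 2))) 1) → ℝ} (hS : Continuous S)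
    {π' : Measure (Λ → sphere (0 : EuclideanSpace ℝ (Fin (n + 2))) 1)} [IsProbabilityMeasure π']
    (hπ' : Kernel.Invariant
      (refreshUpdate
        (involMH ⇑((latticeFlipPerm : Equiv.Perm ((Λ → sphere (0 : EuclideanSpace ℝ (Fin (n + 2))) 1) ×
            (Λ → EuclideanSpace ℝ (Fin (n + 2))))) * latticeLeapfrogPerm F δ ^ 1)
          (measurePreserving_latticeProposal (by rw [Fintype.card_fin]; omega) hF.measurable δ 1).measurable
          fun z : (Λ → sphere (0 : EuclideanSpace ℝ (Fin (n + 2))) 1) × (Λ → EuclideanSpace ℝ (Fin (n + 2))) =>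
            S z.1 + ∑ s, ‖z.2 s‖ ^ 2 / 2)
        (((Measure.pi fun _ : Λ => (volume : Measure (EuclideanSpace ℝ (Fin (n + 2))))).withDensity
            (fun p => ENNReal.ofReal (Real.exp (-(∑ s, ‖p s‖ ^ 2 / 2)))) Set.univ)⁻¹ •
          (Measure.pi fun _ : Λ => (volume : Measure (EuclideanSpace ℝ (Fin (n + 2))))).withDensity
            fun p => ENNReal.ofReal (Real.exp (-(∑ s, ‖p s‖ ^ 2 / 2))))) π') :
    π' = piGibbsLaw (fun _ : Λ => uniformSphere (volume : Measure (EuclideanSpace ℝ (Fin (n + 2)))))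
      (gibbsDensity S) := by
  rw [lattice_sphere_hmc_eq_famLeapfrogHMC n hF.measurable δ 1 S] at hπ'
  exact famLeapfrogHMC_invariant_unique_of_continuous hF hδ hS hπ'

/-- **ROW 7's THMC ON THE LATTICE OF SITE SPHERES AT `nstep = 1` IS UNIFORMLY ERGODIC**: the HMC for
the modified action `S∘Φ − log J` reported through a measurable equivalence `Φ` with
`HasJacobian (⊗ uniformSphere) Φ J`, `0 < j₁ ≤ J ≤ j₂` measurable, bounded measurable `S` (`|S| ≤ s`)
and force (`‖F x i‖ ≤ b`), `δ > 0`: `∃ η ∈ (0, 1]`, `|μ₀K̃ᵗ(A) − π_S(A)| ≤ (1 − η)ᵗ` from every start. -/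
theorem lattice_sphere_thmc_uniformlyErgodic
    {F : (Λ → sphere (0 : EuclideanSpace ℝ (Fin (n + 2))) 1) → (Λ → EuclideanSpace ℝ (Fin (n + 2)))}
    (hF : Measurable F) {δ : ℝ} (hδ : 0 < δ) {b : ℝ} (hb0 : 0 ≤ b) (hb : ∀ x i, ‖F x i‖ ≤ b)
    {S : (Λ → sphere (0 : EuclideanSpace ℝ (Fin (n + 2))) 1) → ℝ} (hS : Measurable S) {s : ℝ}
    (hs : ∀ x, |S x| ≤ s)
    {Φ : (Λ → sphere (0 : EuclideanSpace ℝ (Fin (n + 2))) 1) ≃ᵐ (Λ → sphere (0 : EuclideanSpace ℝ (Fin (n + 2))) 1)}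
    {J : (Λ → sphere (0 : EuclideanSpace ℝ (Fin (n + 2))) 1) → ℝ} {j₁ j₂ : ℝ} (hj₁ : 0 < j₁)
    (hJ₁ : ∀ v, j₁ ≤ J v) (hJ₂ : ∀ v, J v ≤ j₂) (hJm : Measurable J)
    (hΦ : HasJacobian (Measure.pi fun _ : Λ => uniformSphere (volume : Measure (EuclideanSpace ℝ (Fin (n + 2))))) Φ
      fun v => ENNReal.ofReal (J v)) :
    ∃ η : ℝ, 0 < η ∧ η ≤ 1 ∧
      ∀ (μ₀ : Measure (Λ → sphere (0 : EuclideanSpace ℝ (Fin (n + 2))) 1)) [IsProbabilityMeasure μ₀] (t : ℕ)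
        (A : Set (Λ → sphere (0 : EuclideanSpace ℝ (Fin (n + 2))) 1)),
      |((fun m : Measure (Λ → sphere (0 : EuclideanSpace ℝ (Fin (n + 2))) 1) => m.bind
          (conjKernel
            (refreshUpdate
              (involMH ⇑((latticeFlipPerm : Equiv.Perm ((Λ → sphere (0 : EuclideanSpace ℝ (Fin (n + 2))) 1) ×
                  (Λ → EuclideanSpace ℝ (Fin (n + 2))))) * latticeLeapfrogPerm F δ ^ 1)
                (measurePreserving_latticeProposal (by rw [Fintype.card_fin]; omega) hF δ 1).measurable
                fun z : (Λ → sphere (0 : EuclideanSpace ℝ (Fin (n + 2))) 1) × (Λ → EuclideanSpace ℝ (Fin (n + 2))) =>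
                  (S (Φ z.1) - Real.log (J z.1)) + ∑ s, ‖z.2 s‖ ^ 2 / 2)
              (((Measure.pi fun _ : Λ => (volume : Measure (EuclideanSpace ℝ (Fin (n + 2))))).withDensity
                  (fun p => ENNReal.ofReal (Real.exp (-(∑ s, ‖p s‖ ^ 2 / 2)))) Set.univ)⁻¹ •
                (Measure.pi fun _ : Λ => (volume : Measure (EuclideanSpace ℝ (Fin (n + 2))))).withDensity
                  fun p => ENNReal.ofReal (Real.exp (-(∑ s, ‖p s‖ ^ 2 / 2)))))
            Φ))^[t] μ₀).real A
        - (famGibbsLaw (k := fun _ : Λ => n) S).real A| ≤ (1 - η) ^ t := by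
  rw [lattice_sphere_hmc_eq_famLeapfrogHMC n hF δ 1 fun v => S (Φ v) - Real.log (J v)]
  exact famLeapfrogFTHMC_uniformlyErgodic hδ hF hb0 hb hS hs hj₁ hJ₁ hJ₂ hJm hΦ

/-- **… and `famGibbsLaw S = Z_S⁻¹ e^{−S} · ⊗ uniformSphere` is its unique invariant probability law.** -/
theorem lattice_sphere_thmc_invariant_unique
    {F : (Λ → sphere (0 : EuclideanSpace ℝ (Fin (n + 2))) 1) → (Λ → EuclideanSpace ℝ (Fin (n + 2)))}
    (hF : Measurable F) {δ : ℝ} (hδ : 0 < δ) {b : ℝ} (hb0 : 0 ≤ b) (hb : ∀ x i, ‖F x i‖ ≤ b)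
    {S : (Λ → sphere (0 : EuclideanSpace ℝ (Fin (n + 2))) 1) → ℝ} (hS : Measurable S) {s : ℝ}
    (hs : ∀ x, |S x| ≤ s)
    {Φ : (Λ → sphere (0 : EuclideanSpace ℝ (Fin (n + 2))) 1) ≃ᵐ (Λ → sphere (0 : EuclideanSpace ℝ (Fin (n + 2))) 1)}
    {J : (Λ → sphere (0 : EuclideanSpace ℝ (Fin (n + 2))) 1) → ℝ} {j₁ j₂ : ℝ} (hj₁ : 0 < j₁)
    (hJ₁ : ∀ v, j₁ ≤ J v) (hJ₂ : ∀ v, J v ≤ j₂) (hJm : Measurable J)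
    (hΦ : HasJacobian (Measure.pi fun _ : Λ => uniformSphere (volume : Measure (EuclideanSpace ℝ (Fin (n + 2))))) Φ
      fun v => ENNReal.ofReal (J v))
    {π' : Measure (Λ → sphere (0 : EuclideanSpace ℝ (Fin (n + 2))) 1)} [IsProbabilityMeasure π']
    (hπ' : Kernel.Invariant
      (conjKernel
        (refreshUpdate
          (involMH ⇑((latticeFlipPerm : Equiv.Perm ((Λ → sphere (0 : EuclideanSpace ℝ (Fin (n + 2))) 1) ×
              (Λ → EuclideanSpace ℝ (Fin (n + 2))))) * latticeLeapfrogPerm F δ ^ 1)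
            (measurePreserving_latticeProposal (by rw [Fintype.card_fin]; omega) hF δ 1).measurable
            fun z : (Λ → sphere (0 : EuclideanSpace ℝ (Fin (n + 2))) 1) × (Λ → EuclideanSpace ℝ (Fin (n + 2))) =>
              (S (Φ z.1) - Real.log (J z.1)) + ∑ s, ‖z.2 s‖ ^ 2 / 2)
          (((Measure.pi fun _ : Λ => (volume : Measure (EuclideanSpace ℝ (Fin (n + 2))))).withDensity
              (fun p => ENNReal.ofReal (Real.exp (-(∑ s, ‖p s‖ ^ 2 / 2)))) Set.univ)⁻¹ •
            (Measure.pi fun _ : Λ => (volume : Measure (EuclideanSpace ℝ (Fin (n + 2))))).withDensity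
              fun p => ENNReal.ofReal (Real.exp (-(∑ s, ‖p s‖ ^ 2 / 2)))))
        Φ) π') :
    π' = famGibbsLaw (k := fun _ : Λ => n) S := by
  rw [lattice_sphere_hmc_eq_famLeapfrogHMC n hF δ 1 fun v => S (Φ v) - Real.log (J v)] at hπ'
  exact famLeapfrogFTHMC_invariant_unique hδ hF hb0 hb hS hs hj₁ hJ₁ hJ₂ hJm hΦ hπ'

end Lattice

end Summit.Ventures.LatticeQCDFlow.Exactness

end
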